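/-
Origin: expansion seat `prover-pub-hodgecm-mc-binder-2-g7-0`, handover #17 19:22Z md5 a09a1f055f33 (124 l.; imports #9 only; (J-plc)/(J-vac) NAME OF RECORD for the exponents the census reads off: `exists_placeVacExponents` (#9 with the four sign facts bundled as `hsign` and the slot's small datum as `hslot : ∃ ω₁, IsArchWeilDatum (ι𝕎 P' Q' R' S') ω₁ ∧ ∀ u, Continuous (ω₁ u)` — supplied by #8/#11), `placeVacExponents … v eP eQ eR eS hsign hslot : VacExponents` (ONE `Classical.choose`), `placeVacExponents_fockVacuumCharacter`, **`cmBlockRepAt_κ_tensorPi_placeVacExponents`** (`ω′(s(κ k))(Φ₁ ⊠ Φ₂) = (κOp R' S' e_v k Φ₁) ⊠ Φ₂`), `cmArchWeilRep_κ_placeVacExponents` (native frame), pinned differences `placeVacExponents_eR_sub_eS` / `placeVacExponents_eP_sub_eQ`; farm amalgam (3367 l.) rc 0 / 0 err / 0 warn / 0 proof-hole (`g7/certs/PlaceExponents_amalg.json`), `#print axioms placeVacExponents_eP_sub_eQ` = trio (`g7/certs/PlaceExponents_axioms.json`)) (`HOME/mc/pub-hodgecm-mc-binder-2/g7/pkg/HodgeCM/Model/HypCensus/PlaceExponents.lean`,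 md5 a09a1f05, 124 lines);
landed by the gen-13 packager (p-g13) in gate run 37 as `HodgeCM/Model/HypCensus/PlaceExponents.lean` (verbatim).
-/
/-
Origin: speedrun cell pub-hodgecm, MODEL-CONSTRUCTION sub-cell, lineage mc-binder-2 (rows A12/A34 of the binder ledger:
`hyp12` / `hyp34`), seat prover-pub-hodgecm-mc-binder-2-g7-0 (gen 7), 2026-08-19.  Target in PKG:
`HodgeCM/Model/HypCensus/PlaceExponents.lean` (NEW additive leaf; imports this lineage's `TorusBlock` only).  KERNEL only: one `def`
(a `Classical.choose`), its spec, 0 records / named facts / proof holes.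
-/
import Summits.HodgeConjecture.HodgeCM.Model.HypCensus.TorusBlock

/-!
# Census kit (rows A12/A34), (J-plc)/(J-vac): the vacuum exponent tuple OF RECORD at a real place of the CM pin

`TorusBlock` (#9) proves that at a real place `v` there EXISTS one exponent tuple `e_v : VacExponents` through which Konno–Konno's
compact group acts on the (J-arch) datum of the CM pin (`κOp e_v`), a Fock vacuum character of the junction with pinned differences.
The census READS OFF these exponents (BINDER-TRIAGE §50.2 (J-vac): `nVOf`/`nWOf` are functions of them), so they need a NAME:

* **`placeVacExponents … v eP eQ eR eS hsign hslot : VacExponents`** — `Classical.choose` of #9's existence statement, from the sign facts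
  of the pin (`hsign`, the four hypotheses of `hasThetaMajorants_cmPairSplitting_of_signs` bundled) and the slot's small datum
  (`hslot : ∃ ω₁, IsArchWeilDatum (ι𝕎 P' Q' R' S') ω₁ ∧ ∀ u, Continuous (ω₁ u)`, supplied by `SmoothBlockSlot(Neg)`);
* `placeVacExponents_fockVacuumCharacter`, **`cmBlockRepAt_κ_tensorPi_placeVacExponents`** (`ω′(s(κ k))(Φ₁ ⊠ Φ₂) = (κOp e_v k Φ₁) ⊠ Φ₂`),
  **`cmArchWeilRep_κ_placeVacExponents`** (native frame), and the pinned differences `placeVacExponents_eR_sub_eS` (W-indefinite places),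
  `placeVacExponents_eP_sub_eQ` (V-indefinite place).

The ABSOLUTE values depend on the splitting `hGR` (the factor character of the pin at `v`); `VacReadOff` consumes them.  Nothing here is a
claim of PerL/QW8.  Style lint (L-notation): no `local notation`.
-/

set_option autoImplicit false

noncomputable section

open Filter Topology
open NumberField NumberField.InfinitePlace IsDedekindDomain MeasureTheory
open scoped Matrix
open scoped Kronecker Classical TensorProduct ComplexConjugate
open Literature.NumberTheory.Automorphic Literature.NumberTheory.Automorphic.UnitaryGroup Literature.NumberTheory.Weil1964
open Literature.RepresentationTheory.HeisenbergGroup (polar Heisenberg symplecticGroup ofSymplectic)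
open Literature.RepresentationTheory.KonnoKonno2007 Literature.RepresentationTheory.KonnoKonno2007.RealDualPair
open Literature.NumberTheory.GelbartRogawski1991 Literature.NumberTheory.GelbartRogawski1991.UnitaryDualPair
open Literature.Analysis.SegalBargmann Literature.Analysis.Distribution

namespace HodgeCM.Model.HypCensus

section CMPinExponents

variable (L : Type) [Field L] [NumberField L] [IsCMField L] {N M n : ℕ} (e : Fin N × Fin M ≃ Fin n)
variable (dV : Fin N → L) (hdV : ∀ i, IsCMField.complexConj L (dV i) = dV i) (hdV0 : ∀ i, dV i ≠ 0)
variable (dW : Fin M → L) (hdW : ∀ i, IsCMField.complexConj L (dW i) = dW i) (hdW0 : ∀ i, dW i ≠ 0)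
variable (hGR : (cmSplittingDatum L e dV hdV hdV0 dW hdW hdW0).CompatibleSplitting) (ι₁ : L →+* ℂ)
variable (v : {v : InfinitePlace ↥(maximalRealSubfield L) // v.IsReal})
variable {P' Q' R' S' : Type} [Fintype P'] [DecidableEq P'] [Fintype Q'] [DecidableEq Q'] [Fintype R'] [DecidableEq R']
  [Fintype S'] [DecidableEq S']
variable (eP : PosIdx (cmXV L dV hdV ι₁ v) ≃ P') (eQ : NegIdx (cmXV L dV hdV ι₁ v) ≃ Q')
  (eR : PosIdx (cmXW L dV dW hdW ι₁ v) ≃ R') (eS : NegIdx (cmXW L dV dW hdW ι₁ v) ≃ S')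
variable
  (hsign : (∃ i₀ : Fin N, (∀ i, i ≠ i₀ → 0 < (ι₁ (dV i)).re) ∨ ∀ i, i ≠ i₀ → (ι₁ (dV i)).re < 0) ∧
    ((∀ j, 0 < (ι₁ (dW j)).re) ∨ ∀ j, (ι₁ (dW j)).re < 0) ∧
    (∀ τ : L →+* ℂ, InfinitePlace.mk τ ≠ InfinitePlace.mk ι₁ → (∀ i, 0 < (τ (dV i)).re) ∨ ∀ i, (τ (dV i)).re < 0) ∧
    (∀ τ : L →+* ℂ, InfinitePlace.mk τ ≠ InfinitePlace.mk ι₁ →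
      (∃ j₀ : Fin M, ∀ j, j ≠ j₀ → 0 < (τ (dW j)).re) ∨ ∀ j, (τ (dW j)).re < 0))
  (hslot : ∃ ω₁ : Representation ℂ (Ginf P' Q' R' S') (SchwartzMap (DPIdx P' Q' R' S' → ℝ) ℂ),
    IsArchWeilDatum (ι𝕎 P' Q' R' S') ω₁ ∧ ∀ u, Continuous (ω₁ u))

include hsign hslot in
/-- #9 restated with the bundled hypotheses (the existence statement the `def` below chooses from). -/
theorem exists_placeVacExponents :
    ∃ ev : VacExponents, (junction P' Q' R' S').FockVacuumCharacter ev ∧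
      ∀ (k : DPK P' Q' R' S') (Φ₁ : SchwartzMap (DPIdx P' Q' R' S' → ℝ) ℂ)
        (Φ₂ : SchwartzMap (Fin n × {w : {w : InfinitePlace ↥(maximalRealSubfield L) // w.IsReal} // w ≠ v} → ℝ) ℂ),
        cmBlockRepAt L e dV hdV hdV0 dW hdW hdW0 hGR ι₁ v eP eQ eR eS
            (cmBlockSectionAt L dV hdV hdV0 dW hdW hdW0 ι₁ v eP eQ eR eS (κ P' Q' R' S' k)) (tensorPi Φ₁ Φ₂) =
          tensorPi (κOp R' S' ev k Φ₁) Φ₂ := by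
  obtain ⟨ω₁, hW₁, hc₁⟩ := hslot
  exact exists_vacExponents_cmBlockRepAt_κ_tensorPi L e dV hdV hdV0 dW hdW hdW0 hGR ι₁ v eP eQ eR eS hsign.1 hsign.2.1
    hsign.2.2.1 hsign.2.2.2 hW₁ hc₁

/-- **THE VACUUM EXPONENT TUPLE OF RECORD of the CM pin at the real place `v`** (block frame `eP eQ eR eS`): ONE choice, used by every
consumer (`VacReadOff`: `nVOf`/`nWOf`; `OmgIns`). [KonnoKonno2007, Lemma 5.2; Folland1989, Prop. (4.39)] -/
def placeVacExponents : VacExponents :=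
  (exists_placeVacExponents L e dV hdV hdV0 dW hdW hdW0 hGR ι₁ v eP eQ eR eS hsign hslot).choose

/-- the tuple of record is a Fock vacuum character of the junction of the slot. -/
theorem placeVacExponents_fockVacuumCharacter :
    (junction P' Q' R' S').FockVacuumCharacter
      (placeVacExponents L e dV hdV hdV0 dW hdW hdW0 hGR ι₁ v eP eQ eR eS hsign hslot) :=
  (exists_placeVacExponents L e dV hdV hdV0 dW hdW hdW0 hGR ι₁ v eP eQ eR eS hsign hslot).choose_spec.1

/-- **the compact group acts through the tuple of record** (block frame). -/
theorem cmBlockRepAt_κ_tensorPi_placeVacExponents (k : DPK P' Q' R' S') (Φ₁ : SchwartzMap (DPIdx P' Q' R' S' → ℝ) ℂ)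
    (Φ₂ : SchwartzMap (Fin n × {w : {w : InfinitePlace ↥(maximalRealSubfield L) // w.IsReal} // w ≠ v} → ℝ) ℂ) :
    cmBlockRepAt L e dV hdV hdV0 dW hdW hdW0 hGR ι₁ v eP eQ eR eS
        (cmBlockSectionAt L dV hdV hdV0 dW hdW hdW0 ι₁ v eP eQ eR eS (κ P' Q' R' S' k)) (tensorPi Φ₁ Φ₂) =
      tensorPi (κOp R' S' (placeVacExponents L e dV hdV hdV0 dW hdW hdW0 hGR ι₁ v eP eQ eR eS hsign hslot) k Φ₁) Φ₂ :=
  (exists_placeVacExponents L e dV hdV hdV0 dW hdW hdW0 hGR ι₁ v eP eQ eR eS hsign hslot).choose_spec.2 k Φ₁ Φ₂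

/-- **the compact group acts through the tuple of record** (native frame `Ψ = F⁻¹(Φ₁ ⊠ Φ₂)`). -/
theorem cmArchWeilRep_κ_placeVacExponents (k : DPK P' Q' R' S') (Φ₁ : SchwartzMap (DPIdx P' Q' R' S' → ℝ) ℂ)
    (Φ₂ : SchwartzMap (Fin n × {w : {w : InfinitePlace ↥(maximalRealSubfield L) // w.IsReal} // w ≠ v} → ℝ) ℂ) :
    cmArchWeilRep L e dV hdV hdV0 dW hdW hdW0 hGR
        (cmBlockSectionAt L dV hdV hdV0 dW hdW hdW0 ι₁ v eP eQ eR eS (κ P' Q' R' S' k))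
        ((cmBlockFrameAt L e dV hdV hdV0 dW hdW hdW0 ι₁ v eP eQ eR eS).symm (tensorPi Φ₁ Φ₂)) =
      (cmBlockFrameAt L e dV hdV hdV0 dW hdW hdW0 ι₁ v eP eQ eR eS).symm
        (tensorPi (κOp R' S' (placeVacExponents L e dV hdV hdV0 dW hdW hdW0 hGR ι₁ v eP eQ eR eS hsign hslot) k Φ₁) Φ₂) := by
  rw [cmArchWeilRep_eq_symm_cmBlockRepAt L e dV hdV hdV0 dW hdW hdW0 hGR ι₁ v eP eQ eR eS,
    ContinuousLinearEquiv.apply_symm_apply, cmBlockRepAt_κ_tensorPi_placeVacExponents]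

/-- **pinned `W`-side difference** at a `W`-indefinite place: `e_R − e_S = |P'| − |Q'|`. [KonnoKonno2007, Lemma 5.2] -/
theorem placeVacExponents_eR_sub_eS (r₀ : R') (s₀ : S') :
    (placeVacExponents L e dV hdV hdV0 dW hdW hdW0 hGR ι₁ v eP eQ eR eS hsign hslot).eR -
        (placeVacExponents L e dV hdV hdV0 dW hdW hdW0 hGR ι₁ v eP eQ eR eS hsign hslot).eS =
      (Fintype.card P' : ℤ) - Fintype.card Q' :=
  eR_sub_eS (placeVacExponents_fockVacuumCharacter L e dV hdV hdV0 dW hdW hdW0 hGR ι₁ v eP eQ eR eS hsign hslot) r₀ s₀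

/-- **pinned `V`-side difference** at a `V`-indefinite place: `e_P − e_Q = |R'| − |S'|`. [KonnoKonno2007, Lemma 5.2] -/
theorem placeVacExponents_eP_sub_eQ (p₀ : P') (q₀ : Q') :
    (placeVacExponents L e dV hdV hdV0 dW hdW hdW0 hGR ι₁ v eP eQ eR eS hsign hslot).eP -
        (placeVacExponents L e dV hdV hdV0 dW hdW hdW0 hGR ι₁ v eP eQ eR eS hsign hslot).eQ =
      (Fintype.card R' : ℤ) - Fintype.card S' :=
  eP_sub_eQ (placeVacExponents_fockVacuumCharacter L e dV hdV hdV0 dW hdW hdW0 hGR ι₁ v eP eQ eR eS hsign hslot) p₀ q₀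

end CMPinExponents

end HodgeCM.Model.HypCensus

end
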